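import Summits.ValiantsHypothesis.ValiantsHypothesis.Theorems.DepthWindowSumProdTwoLevel
import HarnessLib

/-!
# Route `DepthWindow`, g8 — the `Σ Π Σ Π` builder with extra outer leaf factors

Variant of `exists_append_sumProdSumProd` (`Theorems/DepthWindowSumProdTwoLevel.lean`) needed by
the sliver lemma's application to the fixed-endpoint two-level jump formula
(`weightedHomogeneousComponent_prod_eq_twoLevel_fix`, lens-4 NODE-v8 §10): there the outer
"coefficient" `finVec y = [y₁ = e] · ∏_{l ≥ y₂} [U_l]_0` is not a scalar but a PRODUCT OF LEAVES, so
the outer product gate must carry, besides its `a` inner sum gates, `x` extra leaf operands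
(one product level, fan-in `a + x`):

`Σ_{α<nA} cA α · (∏_{q<a} Σ_{β<nB} cB α q β · ∏_{u<b} leaf α q β u) · ∏_{v<x} extra α v`.

`exists_append_sumProdSumProdMul`: same gate count `nA·a·(nB+1) + nA + 1`, fan-ins `b` (inner) and
`a + x` (outer), depth window `≤ D₀ + 2` for leaves of depth `≤ D₀` and extra factors of depth
`≤ D₀ + 1`, homogeneity from block weights `wt α q` and extra weights `wx α` with
`Σ_q wt α q + wx α = E`.  (Jump-matrix entries `∏_{skipped l} [U_l]_0 · [U_{l'}]_{jump}` of
variable length are padded to a uniform fan-in with `Operand.const 1` by the caller.)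
Generic bookkeeping over a commutative semiring; nothing here bears on `VP ≠ VNP`.

[cite: Burgisser2000, Def. 2.1] [cite: LimayeSrinivasanTavenas2025, Lemma 11]
-/

set_option linter.dupNamespace false

namespace Summit.ValiantsHypothesis.ValiantsHypothesis.Theorems.DepthWindow

open MvPolynomial Literature.Computability.AlgebraicComplexity ArithCircuit Finset
open Literature.Computability.AlgebraicComplexity.DepthReduction

variable {k : Type*} [CommSemiring k] {τ : Type*}

/-- Products over an appended family split. -/
theorem prod_append_eval {a x : ℕ} (G : Fin a → Operand k τ) (X : Fin x → Operand k τ)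
    (V : List (MvPolynomial τ k)) :
    ∏ i : Fin (a + x), (Fin.append G X i).eval V = (∏ q : Fin a, (G q).eval V) * ∏ v : Fin x, (X v).eval V := by
  rw [Fin.prod_univ_add]
  simp only [Fin.append_left, Fin.append_right]

/-- **Generic `Σ Π Σ Π` realisation with extra outer leaf factors** (module docstring).
[cite: Burgisser2000, Def. 2.1] [cite: LimayeSrinivasanTavenas2025, Lemma 11] -/
theorem exists_append_sumProdSumProdMul (w : τ → ℕ) {nA nB a b x : ℕ} (Ψ₀ : List (Gate k τ))
    (cA : Fin nA → k) (cB : Fin nA → Fin a → Fin nB → k)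
    (leaf : Fin nA → Fin a → Fin nB → Fin b → Operand k τ) (extra : Fin nA → Fin x → Operand k τ)
    (D₀ E : ℕ) (wt : Fin nA → Fin a → ℕ) (wx : Fin nA → ℕ)
    (hrefs : ∀ α q β u, (leaf α q β u).RefsBelow Ψ₀.length)
    (hdepth : ∀ α q β u, (leaf α q β u).depthIn (gateWDepths prodWeight Ψ₀) ≤ D₀)
    (hxrefs : ∀ α v, (extra α v).RefsBelow Ψ₀.length)
    (hxdepth : ∀ α v, (extra α v).depthIn (gateWDepths prodWeight Ψ₀) ≤ D₀ + 1)
    (hhom₀ : ∀ g ∈ gateValues Ψ₀, ∃ e : ℕ, IsWeightedHomogeneous w g e)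
    (hwt : ∀ α q β, IsWeightedHomogeneous w
      (∏ u : Fin b, (leaf α q β u).eval (gateValues Ψ₀)) (wt α q))
    (hwx : ∀ α, IsWeightedHomogeneous w (∏ v : Fin x, (extra α v).eval (gateValues Ψ₀)) (wx α))
    (hE : ∀ α, ∑ q : Fin a, wt α q + wx α = E) :
    ∃ (Δ : List (Gate k τ)) (o : Operand k τ),
      Δ.length = nA * a * (nB + 1) + (nA + 1) ∧
      (∀ vs : List (Operand k τ), Gate.prod vs ∈ Δ → vs.length = b ∨ vs.length = a + x) ∧
      (∀ g ∈ gateValues (Ψ₀ ++ Δ), ∃ e : ℕ, IsWeightedHomogeneous w g e) ∧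
      (∀ y ∈ gateWDepths prodWeight (Ψ₀ ++ Δ), y ∈ gateWDepths prodWeight Ψ₀ ∨ y ≤ D₀ + 2) ∧
      o.RefsBelow (Ψ₀ ++ Δ).length ∧
      o.depthIn (gateWDepths prodWeight (Ψ₀ ++ Δ)) ≤ D₀ + 2 ∧
      IsWeightedHomogeneous w (o.eval (gateValues (Ψ₀ ++ Δ))) E ∧
      o.eval (gateValues (Ψ₀ ++ Δ)) =
        ∑ α : Fin nA, C (cA α) * ((∏ q : Fin a, ∑ β : Fin nB, C (cB α q β) *
          ∏ u : Fin b, (leaf α q β u).eval (gateValues Ψ₀)) *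
            ∏ v : Fin x, (extra α v).eval (gateValues Ψ₀)) := by
  -- ℕ-indexed inner data
  set cI : ℕ → Fin nB → k := blockExt cB (fun _ => 0) with hcI
  set oI : ℕ → Fin nB → Fin b → Operand k τ := blockExt leaf (fun _ _ => Operand.const 0) with hoI
  set W : ℕ → ℕ := blockExt wt 0 with hWdef
  have hcI_b : ∀ (α : Fin nA) (q : Fin a), cI ((α : ℕ) * a + q) = cB α q := fun α q => by
    rw [hcI, blockExt_block]
  have hoI_b : ∀ (α : Fin nA) (q : Fin a), oI ((α : ℕ) * a + q) = leaf α q := fun α q => by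
    rw [hoI, blockExt_block]
  have hW_b : ∀ (α : Fin nA) (q : Fin a), W ((α : ℕ) * a + q) = wt α q := fun α q => by
    rw [hWdef, blockExt_block]
  have hrefsI : ∀ i < nA * a, ∀ j u, (oI i j u).RefsBelow Ψ₀.length := by
    intro i hi j u
    obtain ⟨α, q, rfl⟩ := exists_block_of_lt hi
    rw [hoI_b]; exact hrefs α q j u
  have hdpI : ∀ i < nA * a, ∀ j u, (oI i j u).depthIn (gateWDepths prodWeight Ψ₀) ≤ D₀ := by
    intro i hi j u
    obtain ⟨α, q, rfl⟩ := exists_block_of_lt hi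
    rw [hoI_b]; exact hdepth α q j u
  have hWI : ∀ i < nA * a, ∀ j, IsWeightedHomogeneous w
      (∏ u : Fin b, (oI i j u).eval (gateValues Ψ₀)) (W i) := by
    intro i hi j
    obtain ⟨α, q, rfl⟩ := exists_block_of_lt hi
    rw [hoI_b, hW_b]; exact hwt α q j
  obtain ⟨hhom₁, hdep₁, hout₁⟩ :=
    sumProdDelta_spec w cI oI Ψ₀ (nA * a) D₀ W hrefsI hdpI hhom₀ hWI (nA * a) le_rfl
  set Ψ₁ := Ψ₀ ++ sumProdDelta cI oI Ψ₀.length (nA * a) with hΨ₁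
  have hlen₁ : Ψ₁.length = Ψ₀.length + nA * a * (nB + 1) := by
    rw [hΨ₁, List.length_append, length_sumProdDelta]
  obtain ⟨XV, hXV, -⟩ := gateValues_prefix Ψ₀ (sumProdDelta cI oI Ψ₀.length (nA * a))
  obtain ⟨XD, hXD, -⟩ := gateWDepths_prefix prodWeight Ψ₀ (sumProdDelta cI oI Ψ₀.length (nA * a))
  have hxeval : ∀ α v, (extra α v).eval (gateValues Ψ₁) = (extra α v).eval (gateValues Ψ₀) := by
    intro α v
    rw [hΨ₁, hXV]
    exact operand_eval_append_of_refsBelow _ _ ((gateValues_length Ψ₀).symm ▸ hxrefs α v)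
  have hxdep : ∀ α v, (extra α v).depthIn (gateWDepths prodWeight Ψ₁) =
      (extra α v).depthIn (gateWDepths prodWeight Ψ₀) := by
    intro α v
    rw [hΨ₁, hXD]
    exact depthIn_append_of_refsBelow _ _ ((gateWDepths_length prodWeight Ψ₀).symm ▸ hxrefs α v)
  -- the outer block: inner sum gates ++ extra leaves, then the output sum
  set oG : Fin nA → Fin a → Operand k τ := fun α q =>
    Operand.gate (sumProdPos Ψ₀.length nB ((α : ℕ) * a + q)) with hoG
  set oO : Fin nA → Fin (a + x) → Operand k τ := fun α => Fin.append (oG α) (extra α) with hoO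
  have hvalG : ∀ (α : Fin nA) (q : Fin a), (oG α q).eval (gateValues Ψ₁) =
      ∑ β : Fin nB, C (cB α q β) * ∏ u : Fin b, (leaf α q β u).eval (gateValues Ψ₀) := by
    intro α q
    show (gateValues Ψ₁).getD _ 0 = _
    rw [(hout₁ _ (blockIndex_lt α q)).2.1, hcI_b, hoI_b]
  have hhomG : ∀ (α : Fin nA) (q : Fin a),
      IsWeightedHomogeneous w ((oG α q).eval (gateValues Ψ₁)) (wt α q) := by
    intro α q
    show IsWeightedHomogeneous w ((gateValues Ψ₁).getD _ 0) _
    rw [← hW_b α q]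
    exact (hout₁ _ (blockIndex_lt α q)).2.2.1
  have hrefsO : ∀ α i, (oO α i).RefsBelow Ψ₁.length := by
    intro α i
    refine Fin.addCases (fun q => ?_) (fun v => ?_) i
    · show (Fin.append (oG α) (extra α) (Fin.castAdd x q)).RefsBelow _
      rw [Fin.append_left]
      exact (hout₁ _ (blockIndex_lt α q)).1
    · show (Fin.append (oG α) (extra α) (Fin.natAdd a v)).RefsBelow _
      rw [Fin.append_right]
      exact Operand.refsBelow_mono (by rw [hlen₁]; omega) (hxrefs α v)
  have hdpO : ∀ α i, (oO α i).depthIn (gateWDepths prodWeight Ψ₁) ≤ D₀ + 1 := by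
    intro α i
    refine Fin.addCases (fun q => ?_) (fun v => ?_) i
    · show (Fin.append (oG α) (extra α) (Fin.castAdd x q)).depthIn _ ≤ _
      rw [Fin.append_left]
      exact (hout₁ _ (blockIndex_lt α q)).2.2.2
    · show (Fin.append (oG α) (extra α) (Fin.natAdd a v)).depthIn _ ≤ _
      rw [Fin.append_right, hxdep]
      exact hxdepth α v
  have hprodO : ∀ α, ∏ i : Fin (a + x), (oO α i).eval (gateValues Ψ₁) =
      (∏ q : Fin a, (oG α q).eval (gateValues Ψ₁)) *
        ∏ v : Fin x, (extra α v).eval (gateValues Ψ₀) := by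
    intro α
    rw [hoO, prod_append_eval]
    simp_rw [hxeval]
  have hstep := sumProd_step w cA oO Ψ₁ (D₀ + 1) E hrefsO hdpO hhom₁
    (fun α => by
      rw [hprodO, ← hE α]
      exact (IsWeightedHomogeneous.prod Finset.univ (fun q : Fin a => (oG α q).eval (gateValues Ψ₁))
        (fun q => wt α q) (fun q _ => hhomG α q)).mul (hwx α))
  obtain ⟨hL, hfan, hhomS, hdepS, hvalS, hhomvS, hdS⟩ := hstep
  refine ⟨sumProdDelta cI oI Ψ₀.length (nA * a) ++ (prodLayer oO ++ [sumGate cA Ψ₁.length]),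
    Operand.gate (Ψ₁.length + nA), ?_, ?_, ?_⟩
  · rw [List.length_append, length_sumProdDelta, List.length_append, length_prodLayer,
      List.length_singleton]
  · intro vs hvs
    rw [List.mem_append] at hvs
    rcases hvs with h | h
    · exact Or.inl (fanIn_sumProdDelta cI oI _ _ vs h)
    · exact Or.inr (hfan vs h)
  have hshape : Ψ₀ ++ (sumProdDelta cI oI Ψ₀.length (nA * a) ++
      (prodLayer oO ++ [sumGate cA Ψ₁.length])) = Ψ₁ ++ prodLayer oO ++ [sumGate cA Ψ₁.length] := by
    rw [hΨ₁, List.append_assoc, List.append_assoc]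
  rw [hshape]
  refine ⟨hhomS, ?_, ?_, ?_, ?_, ?_⟩
  · intro y hy
    rcases hdepS y hy with hy' | hy'
    · rcases hdep₁ y hy' with hy'' | hy''
      · exact Or.inl hy''
      · exact Or.inr (by omega)
    · exact Or.inr hy'
  · show Ψ₁.length + nA < _
    rw [hL]; omega
  · show (gateWDepths prodWeight _).getD _ 0 ≤ _
    exact hdS
  · show IsWeightedHomogeneous w ((gateValues _).getD _ 0) _
    exact hhomvS
  · show (gateValues _).getD _ 0 = _
    rw [hvalS]
    refine Finset.sum_congr rfl fun α _ => ?_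
    rw [hprodO α]
    congr 2
    exact Finset.prod_congr rfl fun q _ => hvalG α q

end Summit.ValiantsHypothesis.ValiantsHypothesis.Theorems.DepthWindow
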